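import Literature.NumberTheory.Automorphic.UnitaryUnitOrbitalIntegralLatticeCount     -- ★ (L5 socket): `exists_equiv_fixedBy_quotient_congr`, `exists_mem_unitary_span_eq_iff_selfDual_of_nonsplit`
import Literature.NumberTheory.Automorphic.UnitaryUnitOrbitalIntegralFixedPoints     -- ★ (L2 dress): `isRegularElt_val_conj`, `isClosed_conjClass_local_of_isRegularElt`
import Literature.NumberTheory.Automorphic.OrbitalIntegralFixedPointWeighted         -- ★ (U1) weighted unfolding `classOrbitalIntegral_eq_sum_fixedBy_of_support_subset_of_conj_invariant_of_measure_eq_one`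
import Literature.NumberTheory.Automorphic.FixedCosetsStableLatticesSep              -- ★ L2a `ncard_sep_fixedBy_unitary_eq_ncard`
import Literature.NumberTheory.Automorphic.FixedCosetsLevelShift                     -- ★ B-p10 `map_eq_self_and_level_iff_map_levelShift_le`, `valuation_inv_mul_le_one_iff`
import Literature.NumberTheory.Automorphic.FixedCosetsFiniteOfCompactCentralizer     -- ★ `finite_fixedBy_quotient_of_isClosed`
import Literature.NumberTheory.Automorphic.FixedPointsQuotientFibration              -- ★ B-p04 `inv_mul_mul_mem_of_smul_eq`
import HarnessLib

/-!
# The LEVEL-`c` lattice-count socket: the orbital integral of a `K_v`-class function cutting out «`g⁻¹γg ≡ 1 (mod c)`» is the NUMBER OF SELF-DUAL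
# `γ_w`-STABLE `𝒪_w`-LATTICES ON WHICH `γ_w` ACTS AT LEVEL `c` (Kottwitz 1986 §3; Rogawski 1990 §4.9; the level-shift law of the S3 table)

Topic `NumberTheory/Automorphic`; namespace `Literature.NumberTheory.Automorphic`.  THEOREMS ONLY (no definition, no instance, no notation, no named fact,
no `sorry`).  Cell `pub/hodgecm-mathlib`, crux H413, road «S3-tree» brick **T6-2b ∕ O8c** (the generic LEVEL ADAPTER behind the H-side rows `Φ(γH, 1_{K_H(j)})`
of the germ table and T3′'s «H-values near 1»; END∕T6 holder F0P3a-p03 (g14)).  HC_CM is proved only modulo the cell's 2 remaining named inputs (hLiu418, h413)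
until rung 0 closes; this file is unconditional bookkeeping over ★ sockets.

THE MATHEMATICS.  `G = U(H)(L⁺_v)` at a non-split place `v` (one place `w ∣ v`), `K = U(H)(𝒪_v)`, `γ ∈ G` regular elliptic, `m` canonical, `ν(K) = 1`.  For a test
function `f` supported in `K`, `K`-conjugation invariant, with `f(x) = [x_w ≡ 1 (mod c)]` on `K` (`0 < |c| < 1`; `c = ϖ_w^j` gives `1_{K(j)}` extended by zero),
the weighted unfolding (★ (U1)) gives `Φ(⟦γ⟧, f) = Σ_{q ∈ Fix_γ(G⧸K)} f(q⁻¹γq) = #{q ∈ Fix_γ : q⁻¹γq ≡ 1 (mod c)}` (§2); along the one-place model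
`G ≃ U(σ_w, H_w)(L_w)` (★ `localNonsplitEquiv`, §1 transports SEPARATED fixed cosets) and the coset–lattice dictionary (★ L2a, separated version) with B-p10's
level token (★ `map_eq_self_and_level_iff_map_levelShift_le`: «`g⁻¹γg ≡ 1 (mod c)`» iff `(1 + c⁻¹(γ − 1))Λ(g) ⊆ Λ(g)`), this is
`#{Λ self-dual : γ_w Λ = Λ, (1 + c⁻¹(γ_w − 1))Λ ⊆ Λ}` (§3–§4).  With ★ T6-2 (`PlaneLatticesCompanionSelfDualLevelCount`) resp. ★ A-p13
(`SelfDualStableLatticeLevelBallCount`) downstream, this yields the type-(2) resp. type-(1) rows `phiHtwo q (N−j)` resp. `phiH q (N−j)` of the S3 table.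

* §1 `ncard_sep_fixedBy_quotient_congr` — separated fixed cosets along `e : G ≃* G′` matching the levels and the separating predicates.
* §2 `finsum_mem_fixedBy_eq_ncard_sep` — `Σᶠ_{q ∈ Fix} f(q⁻¹γq) = #{q ∈ Fix : Y(q⁻¹γq)}` when `f = [Y]` at those points.
* §3 `level_conj_iff_of_mem_glInt`, `ncard_sep_fixedBy_unitary_level_eq_ncard` (form named as a unit of `GL_n`, ★ L2a's currency) and
  `ncard_sep_fixedBy_unitary_level_eq_ncard_of_isUnit` (form named by its invertible MATRIX, ★ `localNonsplitEquiv`'s currency) — the model: level-separated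
  fixed cosets ↔ level lattices.
* §4 `ncard_sep_fixedBy_level_eq_ncard_selfDual_level` (the algebraic half) and `classOrbitalIntegral_level_eq_ncard_selfDual_level` — THE SOCKET on
  `(cmDatum L N H).Local v`.

## References
* [Kottwitz1986] R. E. Kottwitz, *Base change for unit elements of Hecke algebras*, Compositio Math. 60 (1986), §3.
* [Rogawski1990] J. D. Rogawski, *Automorphic Representations of Unitary Groups in Three Variables* (1990), §4.9 Prop. 4.9.1 (b) p. 55.
* [Laumon1995] G. Laumon, *Cohomology of Drinfeld Modular Varieties* I (1996), Lemma (5.3.2) p. 136.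
* [Serre1980Trees] J.-P. Serre, *Trees* (1980), Ch. II §1.1–1.2.
-/

set_option autoImplicit false

noncomputable section

open scoped ValuativeRel Matrix MatrixGroups
open Set MeasureTheory NumberField IsDedekindDomain ValuativeRel

namespace Literature.NumberTheory.Automorphic

open UnitaryGroup Literature.NumberTheory.Rogawski1990

/-! ## §1 Separated fixed cosets along a group isomorphism matching the levels -/

section Congr

variable {G G' : Type*} [Group G] [Group G'] (K : Subgroup G) (K' : Subgroup G') (e : G ≃* G')

/-- **`#{q ∈ Fix_γ(G⧸K) : Y(q⁻¹γq)} = #{q′ ∈ Fix_{eγ}(G′⧸K′) : Y′(q′⁻¹·eγ·q′)}`** along `e : G ≃* G′` with `g ∈ K ↔ e g ∈ K′` and `Y g ↔ Y′ (e g)`, `Y` invariant under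
`K`-conjugation (so that the predicates do not see the choice of representatives). [cite: Kottwitz1986, §3] -/
theorem ncard_sep_fixedBy_quotient_congr (hK : ∀ g : G, g ∈ K ↔ e g ∈ K') (γ : G) (Y : G → Prop) (Y' : G' → Prop) (hY : ∀ g, Y g ↔ Y' (e g))
    (hYK : ∀ k ∈ K, ∀ x, Y (k⁻¹ * x * k) ↔ Y x) :
    {q ∈ MulAction.fixedBy (G ⧸ K) γ | Y (q.out⁻¹ * γ * q.out)}.ncard =
      {q' ∈ MulAction.fixedBy (G' ⧸ K') (e γ) | Y' (q'.out⁻¹ * e γ * q'.out)}.ncard := by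
  classical
  obtain ⟨Φ, hΦ⟩ := exists_equiv_fixedBy_quotient_congr K K' e hK γ
  -- `K′`-invariance of `Y′` (transported back along `e`)
  have hY'K : ∀ k ∈ K', ∀ x, Y' (k⁻¹ * x * k) ↔ Y' x := fun k hk x => by
    have hk' : e.symm k ∈ K := by rw [hK, MulEquiv.apply_symm_apply]; exact hk
    have h := hYK _ hk' (e.symm x)
    rwa [hY, hY, map_mul, map_mul, map_inv, MulEquiv.apply_symm_apply, MulEquiv.apply_symm_apply] at h
  -- the predicates on representatives
  have hrep : ∀ g : G, Y ((g : G ⧸ K).out⁻¹ * γ * (g : G ⧸ K).out) ↔ Y (g⁻¹ * γ * g) := fun g => by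
    obtain ⟨k, hk⟩ := QuotientGroup.mk_out_eq_mul K g
    rw [hk, mul_inv_rev, show (k : G)⁻¹ * g⁻¹ * γ * (g * k) = (k : G)⁻¹ * (g⁻¹ * γ * g) * k by group]
    exact hYK _ k.2 _
  have hrep' : ∀ g' : G', Y' ((g' : G' ⧸ K').out⁻¹ * e γ * (g' : G' ⧸ K').out) ↔ Y' (g'⁻¹ * e γ * g') := fun g' => by
    obtain ⟨k, hk⟩ := QuotientGroup.mk_out_eq_mul K' g'
    rw [hk, mul_inv_rev, show (k : G')⁻¹ * g'⁻¹ * e γ * (g' * k) = (k : G')⁻¹ * (g'⁻¹ * e γ * g') * k by group]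
    exact hY'K _ k.2 _
  refine Set.ncard_congr (fun q hq => ((Φ ⟨q, hq.1⟩ : MulAction.fixedBy (G' ⧸ K') (e γ)) : G' ⧸ K')) ?_ ?_ ?_
  · rintro q ⟨hq, hYq⟩
    refine ⟨(Φ ⟨q, hq⟩).2, ?_⟩
    induction q using QuotientGroup.induction_on with
    | H g =>
      rw [hΦ g hq, hrep', ← map_inv, ← map_mul, ← map_mul, ← hY]
      exact (hrep g).1 hYq
  · intro q₁ q₂ hq₁ hq₂ h
    exact congrArg Subtype.val (Φ.injective (Subtype.ext h))
  · rintro q' ⟨hq', hYq'⟩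
    obtain ⟨⟨q, hq⟩, hqq'⟩ := Φ.surjective ⟨q', hq'⟩
    refine ⟨q, ⟨hq, ?_⟩, by rw [hqq']⟩
    induction q using QuotientGroup.induction_on with
    | H g =>
      have hg' : (e g : G' ⧸ K') = q' := by rw [← hΦ g hq, hqq']
      rw [hrep g, hY, map_mul, map_mul, map_inv, ← hrep' (e g), hg']
      exact hYq'

end Congr

/-! ## §2 A finite sum of a `{0,1}`-valued weight over the fixed cosets is a separated count -/

section Finsum

variable {G : Type*} [Group G] (K : Subgroup G) {R : Type*} [AddCommMonoidWithOne R]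

/-- **`Σᶠ_{q ∈ Fix_γ(G⧸K)} f(q⁻¹γq) = #{q ∈ Fix_γ : Y(q⁻¹γq)}`** when the fixed-point set is finite and `f(q⁻¹γq) = [Y(q⁻¹γq)]` there. [cite: Kottwitz1986, §3] -/
theorem finsum_mem_fixedBy_eq_ncard_sep {γ : G} (hfin : (MulAction.fixedBy (G ⧸ K) γ).Finite) (Y : G → Prop) [DecidablePred Y] (f : G → R)
    (hf : ∀ q ∈ MulAction.fixedBy (G ⧸ K) γ, f (q.out⁻¹ * γ * q.out) = if Y (q.out⁻¹ * γ * q.out) then 1 else 0) :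
    ∑ᶠ q ∈ MulAction.fixedBy (G ⧸ K) γ, f (q.out⁻¹ * γ * q.out) = (({q ∈ MulAction.fixedBy (G ⧸ K) γ | Y (q.out⁻¹ * γ * q.out)}.ncard : ℕ) : R) := by
  classical
  rw [finsum_mem_eq_finite_toFinset_sum _ hfin, Finset.sum_congr rfl (fun q hq => hf q (hfin.mem_toFinset.1 hq)), Finset.sum_boole]
  congr 1
  rw [← Set.ncard_coe_finset]
  congr 1
  ext q
  simp only [Finset.coe_filter, Set.Finite.mem_toFinset, Set.mem_setOf_eq]

end Finsum

/-! ## §3 The one-place model: level-separated fixed cosets are the level lattices -/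

section Model

variable {E : Type*} [Field E] [ValuativeRel E] {n : ℕ} (σ : E →+* E) (J : GL (Fin n) E)

/-- «`M ≡ 1 (mod c)`» entrywise iff `c⁻¹(M − 1)` is integral (`c ≠ 0`). [cite: Kottwitz1986, §3] -/
theorem forall_valuation_sub_one_le_iff_isIntegralMatrix {c : E} (hc : c ≠ 0) (M : Matrix (Fin n) (Fin n) E) :
    (∀ a b, valuation E ((M - 1) a b) ≤ valuation E c) ↔ IsIntegralMatrix (c⁻¹ • (M - 1)) := by
  refine forall_congr' fun a => forall_congr' fun b => ?_
  rw [Matrix.smul_apply, smul_eq_mul, Valuation.mem_integer_iff, valuation_inv_mul_le_one_iff hc]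

/-- **`GL_n(𝒪)`-conjugation preserves the level**: for `k ∈ GL_n(𝒪)`, `k⁻¹Mk ≡ 1 (mod c)` iff `M ≡ 1 (mod c)` (`c⁻¹(k⁻¹Mk − 1) = k⁻¹ · c⁻¹(M − 1) · k`).
[cite: Kottwitz1986, §3] [cite: Serre1980Trees, Ch. II §1.2] -/
theorem level_conj_iff_of_mem_glInt {c : E} (hc : c ≠ 0) {k : GL (Fin n) E} (hk : k ∈ glInt n E) (M : GL (Fin n) E) :
    (∀ a b, valuation E ((((k⁻¹ * M * k : GL (Fin n) E) : Matrix (Fin n) (Fin n) E) - 1) a b) ≤ valuation E c) ↔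
      ∀ a b, valuation E (((M : Matrix (Fin n) (Fin n) E) - 1) a b) ≤ valuation E c := by
  -- the conjugation identity, for any `k`
  have key : ∀ (k M : GL (Fin n) E), c⁻¹ • ((((k⁻¹ * M * k : GL (Fin n) E) : Matrix (Fin n) (Fin n) E)) - 1) =
      ((k⁻¹ : GL (Fin n) E) : Matrix (Fin n) (Fin n) E) * (c⁻¹ • ((M : Matrix (Fin n) (Fin n) E) - 1)) * (k : Matrix (Fin n) (Fin n) E) := fun k M => by
    rw [Units.val_mul, Units.val_mul, Matrix.mul_smul, Matrix.smul_mul, Matrix.mul_sub, Matrix.sub_mul, Matrix.mul_one, Units.inv_mul]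
  have one : ∀ (k M : GL (Fin n) E), k ∈ glInt n E → IsIntegralMatrix (c⁻¹ • ((M : Matrix (Fin n) (Fin n) E) - 1)) →
      IsIntegralMatrix (c⁻¹ • ((((k⁻¹ * M * k : GL (Fin n) E) : Matrix (Fin n) (Fin n) E)) - 1)) := fun k M hk hM => by
    rw [key]
    exact ((isIntegralMatrix_inv_of_mem_glInt hk).mul hM).mul (isIntegralMatrix_of_mem_glInt hk)
  rw [forall_valuation_sub_one_le_iff_isIntegralMatrix hc, forall_valuation_sub_one_le_iff_isIntegralMatrix hc]
  refine ⟨fun h => ?_, one k M hk⟩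
  have := one k⁻¹ (k⁻¹ * M * k) (inv_mem hk) h
  rwa [inv_inv, show k * (k⁻¹ * M * k) * k⁻¹ = M by group] at this

/-- **LEVEL-SEPARATED FIXED COSETS ↔ LEVEL LATTICES** on the model `U = U(σ, J)(E)`, `K = U ∩ GL_n(𝒪)`: `#{q ∈ Fix_γ(U⧸K) : q⁻¹γq ≡ 1 (mod c)} =
#{Λ = Λ(u), u ∈ U : γΛ = Λ, (1 + c⁻¹(γ − 1))Λ ⊆ Λ}` (★ L2a separated dictionary ∘ ★ B-p10 level token). [cite: Kottwitz1986, §3] [cite: Laumon1995, Lemma (5.3.2) p. 136] -/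
theorem ncard_sep_fixedBy_unitary_level_eq_ncard (γ : ↥(unitaryGroupOfForm σ (J : Matrix (Fin n) (Fin n) E))) {c : E} (hc : c ≠ 0)
    (hc1 : valuation E c < 1) :
    {q ∈ MulAction.fixedBy (↥(unitaryGroupOfForm σ (J : Matrix (Fin n) (Fin n) E)) ⧸
          (glInt n E).subgroupOf (unitaryGroupOfForm σ (J : Matrix (Fin n) (Fin n) E))) γ |
        ∀ a b, valuation E (((((q.out⁻¹ * γ * q.out : ↥(unitaryGroupOfForm σ (J : Matrix (Fin n) (Fin n) E))) : GL (Fin n) E) :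
          Matrix (Fin n) (Fin n) E) - 1) a b) ≤ valuation E c}.ncard =
      {Λ : Submodule 𝒪[E] (Fin n → E) |
        (∃ u ∈ unitaryGroupOfForm σ (J : Matrix (Fin n) (Fin n) E), Λ = Submodule.span 𝒪[E] (Set.range ((u : Matrix (Fin n) (Fin n) E))ᵀ)) ∧
          Λ.map ((Matrix.toLin' (((γ : GL (Fin n) E) : Matrix (Fin n) (Fin n) E))).restrictScalars 𝒪[E]) = Λ ∧
          Λ.map ((Matrix.toLin' (1 + c⁻¹ • ((((γ : GL (Fin n) E) : Matrix (Fin n) (Fin n) E)) - 1))).restrictScalars 𝒪[E]) ≤ Λ}.ncard := by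
  rw [← ncard_sep_fixedBy_unitary_eq_ncard σ J γ (fun Λ => Λ.map ((Matrix.toLin' (1 + c⁻¹ • ((((γ : GL (Fin n) E) : Matrix (Fin n) (Fin n) E)) - 1))).restrictScalars 𝒪[E]) ≤ Λ)]
  congr 1
  ext q
  simp only [Set.mem_setOf_eq]
  refine and_congr_right fun hq => ?_
  have hst := (map_span_range_transpose_eq_self_iff_smul_mk_eq_unitary σ J γ q.out).2 (by rw [QuotientGroup.out_eq']; exact hq)
  rw [← map_eq_self_and_level_iff_map_levelShift_le hc hc1 (γ : GL (Fin n) E) (q.out : GL (Fin n) E), Subgroup.coe_mul, Subgroup.coe_mul, Subgroup.coe_inv]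
  exact ⟨fun h => ⟨hst, h⟩, fun h => h.2⟩

/-- **The same for a unitary group named by its FORM MATRIX** `U₀ = U(σ, J₀)(E)`, `J₀` invertible (the currency of ★ `localNonsplitEquiv`'s target): transport
along the identity isomorphism `U(σ, J₀) = U(σ, ↑u(J₀))` (`IsUnit.unit_spec`), done here once so that consumers never juggle the two spellings.
[cite: Kottwitz1986, §3] [cite: Laumon1995, Lemma (5.3.2) p. 136] -/
theorem ncard_sep_fixedBy_unitary_level_eq_ncard_of_isUnit (J₀ : Matrix (Fin n) (Fin n) E) (hJ₀ : IsUnit J₀) (γ : ↥(unitaryGroupOfForm σ J₀))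
    {c : E} (hc : c ≠ 0) (hc1 : valuation E c < 1) :
    {q ∈ MulAction.fixedBy (↥(unitaryGroupOfForm σ J₀) ⧸ (glInt n E).subgroupOf (unitaryGroupOfForm σ J₀)) γ |
        ∀ a b, valuation E (((((q.out⁻¹ * γ * q.out : ↥(unitaryGroupOfForm σ J₀)) : GL (Fin n) E) : Matrix (Fin n) (Fin n) E) - 1) a b) ≤ valuation E c}.ncard =
      {Λ : Submodule 𝒪[E] (Fin n → E) |
        (∃ u ∈ unitaryGroupOfForm σ J₀, Λ = Submodule.span 𝒪[E] (Set.range ((u : Matrix (Fin n) (Fin n) E))ᵀ)) ∧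
          Λ.map ((Matrix.toLin' (((γ : GL (Fin n) E) : Matrix (Fin n) (Fin n) E))).restrictScalars 𝒪[E]) = Λ ∧
          Λ.map ((Matrix.toLin' (1 + c⁻¹ • ((((γ : GL (Fin n) E) : Matrix (Fin n) (Fin n) E)) - 1))).restrictScalars 𝒪[E]) ≤ Λ}.ncard := by
  have hUU : unitaryGroupOfForm σ J₀ = unitaryGroupOfForm σ ((hJ₀.unit : GL (Fin n) E) : Matrix (Fin n) (Fin n) E) :=
    congrArg (unitaryGroupOfForm σ) (IsUnit.unit_spec hJ₀).symm
  -- transport along the identity isomorphism `subgroupCongr hUU` (matrices unchanged)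
  have hK : ∀ g : ↥(unitaryGroupOfForm σ J₀), g ∈ (glInt n E).subgroupOf (unitaryGroupOfForm σ J₀) ↔
      MulEquiv.subgroupCongr hUU g ∈ (glInt n E).subgroupOf (unitaryGroupOfForm σ ((hJ₀.unit : GL (Fin n) E) : Matrix (Fin n) (Fin n) E)) := fun g => by
    rw [Subgroup.mem_subgroupOf, Subgroup.mem_subgroupOf, MulEquiv.subgroupCongr_apply]
  have hYK : ∀ k ∈ (glInt n E).subgroupOf (unitaryGroupOfForm σ J₀), ∀ x : ↥(unitaryGroupOfForm σ J₀),
      (∀ a b, valuation E (((((k⁻¹ * x * k : ↥(unitaryGroupOfForm σ J₀)) : GL (Fin n) E) : Matrix (Fin n) (Fin n) E) - 1) a b) ≤ valuation E c) ↔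
        ∀ a b, valuation E ((((x : GL (Fin n) E) : Matrix (Fin n) (Fin n) E) - 1) a b) ≤ valuation E c := fun k hk x => by
    rw [Subgroup.coe_mul, Subgroup.coe_mul, Subgroup.coe_inv]
    exact level_conj_iff_of_mem_glInt hc (Subgroup.mem_subgroupOf.1 hk) _
  rw [ncard_sep_fixedBy_quotient_congr _ _ (MulEquiv.subgroupCongr hUU) hK γ
    (fun x : ↥(unitaryGroupOfForm σ J₀) => ∀ a b, valuation E ((((x : GL (Fin n) E) : Matrix (Fin n) (Fin n) E) - 1) a b) ≤ valuation E c)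
    (fun x : ↥(unitaryGroupOfForm σ ((hJ₀.unit : GL (Fin n) E) : Matrix (Fin n) (Fin n) E)) =>
      ∀ a b, valuation E ((((x : GL (Fin n) E) : Matrix (Fin n) (Fin n) E) - 1) a b) ≤ valuation E c)
    (fun g => by rw [MulEquiv.subgroupCongr_apply]) hYK,
    ncard_sep_fixedBy_unitary_level_eq_ncard σ hJ₀.unit _ hc hc1, MulEquiv.subgroupCongr_apply, ← hUU]

end Model

/-! ## §4 THE LEVEL SOCKET on `U(H)(L⁺_v)` at a non-split unramified place -/

section Nonsplit

variable (L : Type) [Field L] [NumberField L] [IsCMField L] (N : ℕ) (H : Matrix (Fin N) (Fin N) L)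
  {v : HeightOneSpectrum (𝓞 ↥(maximalRealSubfield L))} (hc : IsCMField.complexConj L ≠ 1)
  (w : UnitaryGroup.PlacesOver L v) (hw : IsCMField.complexConj L • w.1 = w.1)

set_option maxHeartbeats 400000 in
/-- **LEVEL-SEPARATED FIXED COSETS OF `U(H)(L⁺_v) ⧸ U(H)(𝒪_v)` ↔ SELF-DUAL LEVEL LATTICES** (the algebraic half of the socket): at a non-split unramified `v`
with `H_w ∈ GL_N(𝒪_w)`, `#{q ∈ Fix_γ : (q⁻¹γq)_w ≡ 1 (mod c)} = #{Λ self-dual : γ_wΛ = Λ, (1 + c⁻¹(γ_w − 1))Λ ⊆ Λ}` — §1 along ★ `localNonsplitEquiv` (the model's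
form named as the unit `hJw.unit`, identified by `IsUnit.unit_spec`), §3, ★ `exists_mem_unitary_span_eq_iff_selfDual_of_nonsplit`.
[cite: Kottwitz1986, §3] [cite: Laumon1995, Lemma (5.3.2) p. 136] -/
theorem ncard_sep_fixedBy_level_eq_ncard_selfDual_level (hH : (H.map (cmConjRingHom L))ᵀ = H)
    (γ : (cmDatum L N H).Local v) (hv : Algebra.IsUnramifiedIn (𝓞 L) v.asIdeal) (hJw : IsUnit (placeForm H w.1))
    (hJi : hJw.unit ∈ glInt N (w.1.adicCompletion L)) {c : w.1.adicCompletion L} (hc0 : c ≠ 0) (hc1 : valuation (w.1.adicCompletion L) c < 1) :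
    {q ∈ MulAction.fixedBy ((cmDatum L N H).Local v ⧸ cmLocalIntegralLevel L N H v) γ |
        (∀ a b, valuation (w.1.adicCompletion L) (((((((localNonsplitEquiv (IsCMField.complexConj L) H hc w hw) (q.out⁻¹ * γ * q.out) : ↥(unitaryGroupOfForm (galAdicCompletionMap (L := L) (IsCMField.complexConj L) hw) (placeForm H w.1))) : GL (Fin N) (w.1.adicCompletion L))) : Matrix (Fin N) (Fin N) (w.1.adicCompletion L)) - 1) a b) ≤ valuation (w.1.adicCompletion L) c)}.ncard =
      {Λ : Submodule 𝒪[w.1.adicCompletion L] (Fin N → w.1.adicCompletion L) |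
        (∃ g : GL (Fin N) (w.1.adicCompletion L),
          (∃ J' ∈ glInt N (w.1.adicCompletion L), (J' : Matrix (Fin N) (Fin N) (w.1.adicCompletion L)) =
            formCongr (galAdicCompletionMap (L := L) (IsCMField.complexConj L) hw) g (placeForm H w.1)) ∧
          Λ = Submodule.span 𝒪[w.1.adicCompletion L] (Set.range ((g : Matrix (Fin N) (Fin N) (w.1.adicCompletion L)))ᵀ)) ∧
        Λ.map ((Matrix.toLin' ((((localNonsplitEquiv (IsCMField.complexConj L) H hc w hw) γ : ↥(unitaryGroupOfForm (galAdicCompletionMap (L := L) (IsCMField.complexConj L) hw) (placeForm H w.1))) : GL (Fin N) (w.1.adicCompletion L)) : Matrix (Fin N) (Fin N) (w.1.adicCompletion L))).restrictScalars 𝒪[w.1.adicCompletion L]) = Λ ∧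
        Λ.map ((Matrix.toLin' (1 + c⁻¹ • (((((localNonsplitEquiv (IsCMField.complexConj L) H hc w hw) γ : ↥(unitaryGroupOfForm (galAdicCompletionMap (L := L) (IsCMField.complexConj L) hw) (placeForm H w.1))) : GL (Fin N) (w.1.adicCompletion L)) : Matrix (Fin N) (Fin N) (w.1.adicCompletion L)) - 1))).restrictScalars 𝒪[w.1.adicCompletion L]) ≤ Λ}.ncard := by
  -- `K_v ↦ U ∩ GL_N(𝒪_w)` along `e = localNonsplitEquiv` (its native target `U = U(σ_w, H_w)(L_w)`)
  have hK : ∀ g : (cmDatum L N H).Local v, g ∈ cmLocalIntegralLevel L N H v ↔ (localNonsplitEquiv (IsCMField.complexConj L) H hc w hw).toMulEquiv g ∈ ((glInt N (w.1.adicCompletion L)).subgroupOf (unitaryGroupOfForm (galAdicCompletionMap (L := L) (IsCMField.complexConj L) hw) (placeForm H w.1))) := fun g =>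
    (mem_localIntegralLevel_iff_of_smul_eq (IsCMField.complexConj L) N H hc w hw g).trans Subgroup.mem_subgroupOf.symm
  -- `K_v`-conjugation invariance of the level predicate (read on `U`; elements typed on the `«local»` carrier, `cmDatum_Local` is `rfl`)
  have hYK : ∀ k : «local» L (IsCMField.complexConj L) N H v, k ∈ localIntegralLevel (IsCMField.complexConj L) N H v →
      ∀ x : «local» L (IsCMField.complexConj L) N H v,
      (∀ a b, valuation (w.1.adicCompletion L) (((((((localNonsplitEquiv (IsCMField.complexConj L) H hc w hw) (k⁻¹ * x * k) : ↥(unitaryGroupOfForm (galAdicCompletionMap (L := L) (IsCMField.complexConj L) hw) (placeForm H w.1))) : GL (Fin N) (w.1.adicCompletion L))) : Matrix (Fin N) (Fin N) (w.1.adicCompletion L)) - 1) a b) ≤ valuation (w.1.adicCompletion L) c) ↔ (∀ a b, valuation (w.1.adicCompletion L) (((((((localNonsplitEquiv (IsCMField.complexConj L) H hc w hw) x : ↥(unitaryGroupOfForm (galAdicCompletionMap (L := L) (IsCMField.complexConj L) hw) (placeForm H w.1))) : GL (Fin N) (w.1.adicCompletion L))) : Matrix (Fin N) (Fin N) (w.1.adicCompletion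 L)) - 1) a b) ≤ valuation (w.1.adicCompletion L) c) := fun k hk x => by
    have hk' := (mem_localIntegralLevel_iff_of_smul_eq (IsCMField.complexConj L) N H hc w hw k).1 hk
    rw [map_mul, map_mul, map_inv, Subgroup.coe_mul, Subgroup.coe_mul, Subgroup.coe_inv]
    exact level_conj_iff_of_mem_glInt hc0 hk' _
  refine (ncard_sep_fixedBy_quotient_congr (cmLocalIntegralLevel L N H v) ((glInt N (w.1.adicCompletion L)).subgroupOf (unitaryGroupOfForm (galAdicCompletionMap (L := L) (IsCMField.complexConj L) hw) (placeForm H w.1))) (localNonsplitEquiv (IsCMField.complexConj L) H hc w hw).toMulEquiv hK γ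
    (fun x : (cmDatum L N H).Local v => (∀ a b, valuation (w.1.adicCompletion L) (((((((localNonsplitEquiv (IsCMField.complexConj L) H hc w hw) x : ↥(unitaryGroupOfForm (galAdicCompletionMap (L := L) (IsCMField.complexConj L) hw) (placeForm H w.1))) : GL (Fin N) (w.1.adicCompletion L))) : Matrix (Fin N) (Fin N) (w.1.adicCompletion L)) - 1) a b) ≤ valuation (w.1.adicCompletion L) c))
    (fun u : ↥(unitaryGroupOfForm (galAdicCompletionMap (L := L) (IsCMField.complexConj L) hw) (placeForm H w.1)) => (∀ a b, valuation (w.1.adicCompletion L) (((((u : GL (Fin N) (w.1.adicCompletion L))) : Matrix (Fin N) (Fin N) (w.1.adicCompletion L)) - 1) a b) ≤ valuation (w.1.adicCompletion L) c)) (fun _ => Iff.rfl) hYK).trans ?_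
  -- the model count (§3, form-matrix spelling), then self-duality of the `U`-orbit (★)
  refine (ncard_sep_fixedBy_unitary_level_eq_ncard_of_isUnit (galAdicCompletionMap (L := L) (IsCMField.complexConj L) hw) (placeForm H w.1) hJw
    ((localNonsplitEquiv (IsCMField.complexConj L) H hc w hw).toMulEquiv γ) hc0 hc1).trans ?_
  congr 1
  ext Λ
  simp only [mem_setOf_eq]
  rw [exists_mem_unitary_span_eq_iff_selfDual_of_nonsplit L N H hc w hw hv hH hJw hJi Λ]
  exact Iff.rfl

variable [MeasurableSpace ((cmDatum L N H).Local v)] [BorelSpace ((cmDatum L N H).Local v)]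
  [∀ γ : (cmDatum L N H).Local v, MeasurableSpace ((cmDatum L N H).Local v ⧸ Subgroup.centralizer ({γ} : Set ((cmDatum L N H).Local v)))]
  [∀ γ : (cmDatum L N H).Local v, BorelSpace ((cmDatum L N H).Local v ⧸ Subgroup.centralizer ({γ} : Set ((cmDatum L N H).Local v)))]
  (ν : Measure ((cmDatum L N H).Local v)) [Measure.IsHaarMeasure ν] [ν.IsMulRightInvariant]

/-- **THE LEVEL SOCKET — `Φ(⟦γ⟧, f; m) = #{self-dual 𝒪_w-lattices Λ : γ_w Λ = Λ, (1 + c⁻¹(γ_w − 1))Λ ⊆ Λ}`** for `m` canonical, `ν(U(H)(𝒪_v)) = 1`, `γ` regular elliptic,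
`v` non-split unramified with `H_w ∈ GL_N(𝒪_w)`, and a CONTINUOUS test function `f` supported in `K_v = U(H)(𝒪_v)`, `K_v`-conjugation invariant, equal on `K_v` to the
characteristic function of «`x_w ≡ 1 (mod c)`» (`0 < |c| < 1`; `c = ϖ_w^j`: `f = 1_{K_v(j)}`).  ★ (U1) ∘ §2 ∘ §1 ∘ §3 ∘ ★ `exists_mem_unitary_span_eq_iff_selfDual_of_nonsplit`.
[cite: Rogawski1990, §4.9 Prop. 4.9.1 (b) p. 55] [cite: Kottwitz1986, §3] [cite: Laumon1995, Lemma (5.3.2) p. 136] -/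
theorem classOrbitalIntegral_level_eq_ncard_selfDual_level (hH : (H.map (cmConjRingHom L))ᵀ = H) (hdet : H.det ≠ 0)
    {m : OrbitalMeasureFamily ((cmDatum L N H).Local v)} (hm : m.IsCanonical (fun γ => IsRegularElt (γ.val : GL (Fin N) (LocalRing L v))) ν)
    (hν : ν (cmLocalIntegralLevel L N H v : Set ((cmDatum L N H).Local v)) = 1)
    (γ : (cmDatum L N H).Local v) (hreg : IsRegularElt (γ.val : GL (Fin N) (LocalRing L v)))
    [CompactSpace (Subgroup.centralizer ({γ} : Set ((cmDatum L N H).Local v)))]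
    (hv : Algebra.IsUnramifiedIn (𝓞 L) v.asIdeal) (hJw : IsUnit (placeForm H w.1)) (hJi : hJw.unit ∈ glInt N (w.1.adicCompletion L))
    {c : w.1.adicCompletion L} (hc0 : c ≠ 0) (hc1 : valuation (w.1.adicCompletion L) c < 1)
    (f : (cmDatum L N H).Local v → ℂ) (hfc : Continuous f) (hfK : Function.support f ⊆ (cmLocalIntegralLevel L N H v : Set ((cmDatum L N H).Local v)))
    (hfinv : ∀ k ∈ cmLocalIntegralLevel L N H v, ∀ x, f (k * x * k⁻¹) = f x)
    (hf1 : ∀ x ∈ cmLocalIntegralLevel L N H v, (∀ a b, valuation (w.1.adicCompletion L)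
      (((((localNonsplitEquiv (IsCMField.complexConj L) H hc w hw x :
        unitaryGroupOfForm (galAdicCompletionMap (L := L) (IsCMField.complexConj L) hw) (placeForm H w.1)) :
          GL (Fin N) (w.1.adicCompletion L)) : Matrix (Fin N) (Fin N) (w.1.adicCompletion L)) - 1) a b) ≤ valuation (w.1.adicCompletion L) c) → f x = 1)
    (hf0 : ∀ x ∈ cmLocalIntegralLevel L N H v, ¬ (∀ a b, valuation (w.1.adicCompletion L)
      (((((localNonsplitEquiv (IsCMField.complexConj L) H hc w hw x :
        unitaryGroupOfForm (galAdicCompletionMap (L := L) (IsCMField.complexConj L) hw) (placeForm H w.1)) :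
          GL (Fin N) (w.1.adicCompletion L)) : Matrix (Fin N) (Fin N) (w.1.adicCompletion L)) - 1) a b) ≤ valuation (w.1.adicCompletion L) c) → f x = 0) :
    classOrbitalIntegral m f (ConjClasses.mk γ) =
      ({Λ : Submodule 𝒪[w.1.adicCompletion L] (Fin N → w.1.adicCompletion L) |
        (∃ g : GL (Fin N) (w.1.adicCompletion L),
          (∃ J' ∈ glInt N (w.1.adicCompletion L), (J' : Matrix (Fin N) (Fin N) (w.1.adicCompletion L)) =
            formCongr (galAdicCompletionMap (L := L) (IsCMField.complexConj L) hw) g (placeForm H w.1)) ∧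
          Λ = Submodule.span 𝒪[w.1.adicCompletion L] (Set.range ((g : Matrix (Fin N) (Fin N) (w.1.adicCompletion L)))ᵀ)) ∧
        Λ.map ((Matrix.toLin' (((localNonsplitEquiv (IsCMField.complexConj L) H hc w hw γ :
            unitaryGroupOfForm (galAdicCompletionMap (L := L) (IsCMField.complexConj L) hw) (placeForm H w.1)) :
              GL (Fin N) (w.1.adicCompletion L)) : Matrix (Fin N) (Fin N) (w.1.adicCompletion L))).restrictScalars 𝒪[w.1.adicCompletion L]) = Λ ∧
        Λ.map ((Matrix.toLin' (1 + c⁻¹ • ((((localNonsplitEquiv (IsCMField.complexConj L) H hc w hw γ :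
            unitaryGroupOfForm (galAdicCompletionMap (L := L) (IsCMField.complexConj L) hw) (placeForm H w.1)) :
              GL (Fin N) (w.1.adicCompletion L)) : Matrix (Fin N) (Fin N) (w.1.adicCompletion L)) - 1))).restrictScalars 𝒪[w.1.adicCompletion L]) ≤ Λ}.ncard : ℂ) := by
  classical
  have hKco := isCompact_isOpen_cmLocalIntegralLevel L N H v
  have hO := isClosed_conjClass_local_of_isRegularElt L N H v hH hdet γ hreg
  rw [classOrbitalIntegral_eq_sum_fixedBy_of_support_subset_of_conj_invariant_of_measure_eq_one
    (P := fun γ : (cmDatum L N H).Local v => IsRegularElt (γ.val : GL (Fin N) (LocalRing L v)))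
    (fun g x hg => isRegularElt_val_conj L N H v g x hg) hm hreg (cmLocalIntegralLevel L N H v) hKco.2 hKco.1 hν hO f hfc hfK hfinv]
  have hfin := finite_fixedBy_quotient_of_isClosed γ (cmLocalIntegralLevel L N H v) hO hKco.2 hKco.1
  -- the values of `f` on the fixed cosets
  have hfY : ∀ q ∈ MulAction.fixedBy ((cmDatum L N H).Local v ⧸ cmLocalIntegralLevel L N H v) γ,
      f (q.out⁻¹ * γ * q.out) =
        if (∀ a b, valuation (w.1.adicCompletion L) ((((((localNonsplitEquiv (IsCMField.complexConj L) H hc w hw) (q.out⁻¹ * γ * q.out) : ↥(unitaryGroupOfForm (galAdicCompletionMap (L := L) (IsCMField.complexConj L) hw) (placeForm H w.1))) : GL (Fin N) (w.1.adicCompletion L)) : Matrix (Fin N) (Fin N) (w.1.adicCompletion L)) - 1) a b) ≤ valuation (w.1.adicCompletion L) c) then 1 else 0 := fun q hq => by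
    have hmem : q.out⁻¹ * γ * q.out ∈ cmLocalIntegralLevel L N H v :=
      inv_mul_mul_mem_of_smul_eq Quotient.out QuotientGroup.out_eq' γ hq
    by_cases hYq : (∀ a b, valuation (w.1.adicCompletion L) ((((((localNonsplitEquiv (IsCMField.complexConj L) H hc w hw) (q.out⁻¹ * γ * q.out) : ↥(unitaryGroupOfForm (galAdicCompletionMap (L := L) (IsCMField.complexConj L) hw) (placeForm H w.1))) : GL (Fin N) (w.1.adicCompletion L)) : Matrix (Fin N) (Fin N) (w.1.adicCompletion L)) - 1) a b) ≤ valuation (w.1.adicCompletion L) c)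
    · rw [if_pos hYq]; exact hf1 _ hmem hYq
    · rw [if_neg hYq]; exact hf0 _ hmem hYq
  rw [finsum_mem_fixedBy_eq_ncard_sep (cmLocalIntegralLevel L N H v) hfin
    (fun x : (cmDatum L N H).Local v => (∀ a b, valuation (w.1.adicCompletion L) ((((((localNonsplitEquiv (IsCMField.complexConj L) H hc w hw) x : ↥(unitaryGroupOfForm (galAdicCompletionMap (L := L) (IsCMField.complexConj L) hw) (placeForm H w.1))) : GL (Fin N) (w.1.adicCompletion L)) : Matrix (Fin N) (Fin N) (w.1.adicCompletion L)) - 1) a b) ≤ valuation (w.1.adicCompletion L) c)) f hfY]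
  congr 1
  exact ncard_sep_fixedBy_level_eq_ncard_selfDual_level L N H hc w hw hH γ hv hJw hJi hc0 hc1

end Nonsplit

end Literature.NumberTheory.Automorphic

end
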